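import Summits.BirchSwinnertonDyer.BirchSwinnertonDyer.Theorems.GoldfeldAllTwistsTwoConverseTwinGenusOddMultipleTrace
import Literature.NumberTheory.EllipticCurves.ImaginaryPeriod
import Literature.NumberTheory.EllipticCurves.BSDQuadraticDescentArchimedeanProofs
import HarnessLib

set_option linter.dupNamespace false
set_option autoImplicit false

/-!
# LINE B49, genus assembly (A), step W-A4 (part): the period relation of the fixed partner `784`
# in tree currency — `Ω(W₇₈₄) · Ω(X₀(49)) = covol(Λ_{X₀(49)})` (constant chain C5 of GENUS-THEOREM-A.md)

Cell `bsd-goldfeld`, seat `bsd-goldfeld-s1p-c3` (prover, gen 7); memo `HOME/GENUS-THEOREM-A.md` §3 row C5 (numerically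
`Ω(W784) = covol/Ω(cm7) = 2.5575309899…`, kit j266252). Support for item `stmt-BirchSwinnertonDyer-19140`. Clean
cone. HONEST FRAMING: an identity between real numbers attached to two explicit Weierstrass models; nothing about
`L`-values or BSD. INPUTS (all PROVED in the tree): Pal 2012 Thm 3.2 for `d < 0`
(`realPeriodRat_mul_sqrt_of_twist_of_neg`, `ImaginaryPeriod.lean`), the Legendre/area relation
`Ω · |Ω⁻| = 2 covol` (`realPeriodRat_mul_imaginaryPeriodRat`, `complexPeriod_map_eq_two_mul_covolume`), and the
explicit change of variables `(1, −1, 0, 0) • cm7^{(−4)} = W₇₈₄ = [0,0,0,−35,98]` (`u = 1`, so Pal's `ũ = 1`):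
hence `Ω(W₇₈₄) · √4 = |Ω⁻(cm7)|` (one real component: `Δ(W₇₈₄) = −2¹²·7³ < 0`) and
`Ω(W₇₈₄) · Ω(cm7) = covol(Λ)` for the Néron lattice `Λ = D₀.L.lattice` of ANY parametrisation datum `D₀` of
`cm7` (the lattice entering Cai–Shu–Tian's constant `2 covol(Λ)/(c² u² √|d_K|)`).

References: V. Pal, Proc. AMS 140 (2012) Thm 3.2 [Pal2012]; J. E. Cremona, *Algorithms* (1997) §3.7
[CremonaAlgorithms1997].
-/

noncomputable section

open scoped Classical

open WeierstrassCurve Literature.NumberTheory.EllipticCurves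
  Literature.NumberTheory.EllipticCurves.ModularForms

namespace Summit.BirchSwinnertonDyer.BirchSwinnertonDyer.Theorems.GoldfeldGoodTwists

/-- `(1, −1, 0, 0) • cm7^{(−4)} = [0, 0, 0, −35, 98]` (`cm7^{(−4)} = [0, 3, 0, −32, 64]`; translate `x ↦ x − 1`),
the minimal model `784.?` of `49a1^{(−1)}` in Cremona's table; `u = 1`. [cite: CremonaAlgorithms1997, Table 1 (784)] -/
theorem smul_cm7_quadraticTwist_neg_four :
    (⟨1, -1, 0, 0⟩ : VariableChange ℚ) • cm7.quadraticTwist (-4) = (⟨0, 0, 0, -35, 98⟩ : WeierstrassCurve ℚ) := by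
  ext <;> simp [quadraticTwist, b₂, b₄, b₆, variableChange_a₁, variableChange_a₂, variableChange_a₃,
    variableChange_a₄, variableChange_a₆] <;> norm_num

/-- `[0,0,0,−35,98]` has one real component (`Δ = −2¹²·7³ < 0`). [cite: CremonaAlgorithms1997, §3.7] -/
theorem numRealComponents_w784 :
    ((⟨0, 0, 0, -35, 98⟩ : WeierstrassCurve ℚ).baseChange ℝ).numRealComponents = 1 := by
  rw [numRealComponents_baseChange_real]
  have hΔ : (⟨0, 0, 0, -35, 98⟩ : WeierstrassCurve ℚ).Δ = -1404928 := by
    simp [WeierstrassCurve.Δ, b₂, b₄, b₆, b₈]; norm_num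
  rw [hΔ]; norm_num

/-- **Pal for `d = −4` on `X₀(49)`: `2 · Ω(W₇₈₄) = |Ω⁻(cm7)|`** (`Ω = realPeriodRat`, all real components;
`|Ω⁻| = imaginaryPeriodRat`). [cite: Pal2012, Thm. 3.2 (case d < 0)] -/
theorem two_mul_realPeriodRat_w784 :
    2 * (⟨0, 0, 0, -35, 98⟩ : WeierstrassCurve ℚ).realPeriodRat = cm7.imaginaryPeriodRat := by
  have h := cm7.realPeriodRat_mul_sqrt_of_twist_of_neg (d := -4) (by norm_num) _ _ smul_cm7_quadraticTwist_neg_four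
  have h4 : Real.sqrt (-((-4 : ℚ) : ℝ)) = 2 := by
    rw [show (-((-4 : ℚ) : ℝ)) = (2 : ℝ) ^ 2 by push_cast; norm_num, Real.sqrt_sq (by norm_num)]
  rw [h4, numRealComponents_w784] at h
  simpa [mul_comm] using h

/-- `c₄(cm7 ⊗ F) = 105`, `c₆(cm7 ⊗ F) = 1323`. [folklore] -/
theorem c₄_c₆_cm7_baseChange (F : Type*) [Field F] [CharZero F] :
    (cm7.baseChange F).c₄ = 105 ∧ (cm7.baseChange F).c₆ = 1323 := by
  constructor
  · simp [baseChange, c₄, b₂, b₄]; norm_num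
  · simp [baseChange, c₆, b₂, b₄, b₆]; norm_num

/-- **`Ω(W₇₈₄) · Ω(cm7) = covol(Λ)`** for the Néron lattice `Λ` of ANY parametrisation datum of `X₀(49) = cm7`
(at any level): `2 Ω(W₇₈₄) = |Ω⁻(cm7)|` (Pal, `d = −4`, `ũ = 1`), `Ω(cm7)·|Ω⁻(cm7)| = 2 covol(Λ)` (Legendre
relation for a period pair with `g₂ = c₄/12`, `g₃ = c₆/216` — which `D₀.L` is, `D₀.isNeronLattice`). Row C5 of the
constant chain of Theorem A. [cite: Pal2012, Thm. 3.2 (case d < 0)] [cite: CremonaAlgorithms1997, §3.7] -/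
theorem realPeriodRat_w784_mul_realPeriodRat_cm7 {N : ℕ} [NeZero N] (D₀ : ModularParametrizationData cm7 N) :
    (⟨0, 0, 0, -35, 98⟩ : WeierstrassCurve ℚ).realPeriodRat * cm7.realPeriodRat = ZLattice.covolume D₀.L.lattice := by
  obtain ⟨h₂, h₃⟩ := D₀.isNeronLattice
  obtain ⟨hc4ℂ, hc6ℂ⟩ := c₄_c₆_cm7_baseChange ℂ
  obtain ⟨hc4ℝ, hc6ℝ⟩ := c₄_c₆_cm7_baseChange ℝ
  have hcov := (cm7.baseChange ℝ).complexPeriod_map_eq_two_mul_covolume (L := D₀.L)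
    (by rw [h₂, hc4ℂ, hc4ℝ]; push_cast; ring) (by rw [h₃, hc6ℂ, hc6ℝ]; push_cast; ring)
  have hleg := cm7.realPeriodRat_mul_imaginaryPeriodRat
  rw [hcov, ← two_mul_realPeriodRat_w784] at hleg
  linarith

end Summit.BirchSwinnertonDyer.BirchSwinnertonDyer.Theorems.GoldfeldGoodTwists

end
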